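import Literature.Topology.PlanarFoliations.OfCharts
import HarnessLib

/-!
# Plaques of the foliation of a pre-atlas are connected; plaque-invariant sets contain leaves

Topic: sequel to `OfCharts.lean`.

* `PreAtlas.plaque_eq_image` / `PreAtlas.isConnected_plaque` (**proved**): the plaque of the flow
  box `renormBox c p r` (`box p r ⊆ c.target`) through a point `y` of its source is the image
  under `c⁻¹` of the horizontal segment of the box at the height of `c y`; in particular it
  is connected;
* `Foliation.leaf_subset_of_plaque_invariant` (**proved**, any foliation): a set `S` such that
  every plaque meeting `S` lies in `S` contains the leaf of each of its points.

All statements are [folklore].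
-/

noncomputable section

open Set Filter Topology
open Literature.Topology.FourManifolds

namespace Literature.Topology.FourManifolds.Foliation

variable {B : Type*} [TopologicalSpace B] {M : Type*} [TopologicalSpace M] (F : Foliation B M)

/-- **A plaque-invariant set contains the leaves of its points.** [folklore] -/
theorem leaf_subset_of_plaque_invariant {S : Set M}
    (hS : ∀ e ∈ F.atlas, ∀ z ∈ S, ∀ w, z ∈ e.source → w ∈ e.source → (e z).2 = (e w).2 → w ∈ S)
    {x : M} (hx : x ∈ S) : F.leaf x ⊆ S := by
  intro y hy
  rw [mem_leaf_iff] at hy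
  -- invariance in both directions along the generating relation
  have key : ∀ a b, Relation.EqvGen F.SamePlaque a b → (a ∈ S ↔ b ∈ S) := by
    intro a b h
    induction h with
    | rel a b hab =>
      obtain ⟨e, he, ha, hb, hh⟩ := hab
      exact ⟨fun h ↦ hS e he a h b ha hb hh, fun h ↦ hS e he b h a hb ha hh.symm⟩
    | refl a => exact Iff.rfl
    | symm a b _ ih => exact ih.symm
    | trans a b c _ _ ih₁ ih₂ => exact ih₁.trans ih₂
  exact (key x y hy).1 hx

end Literature.Topology.FourManifolds.Foliation

namespace Literature.Topology.PlanarFoliations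

variable {X : Type*} [TopologicalSpace X]

namespace PreAtlas

/-- **The plaque of a renormalised chart is the preimage of a horizontal segment of the box.**
[folklore] -/
theorem plaque_eq_image {c : OpenPartialHomeomorph X (ℝ × ℝ)} {p : ℝ × ℝ} {r : ℝ} {hr : 0 < r}
    (hbox : box p r ⊆ c.target) {y : X} (hy : y ∈ (renormBox c p r hr).source) :
    {z | z ∈ (renormBox c p r hr).source ∧ (renormBox c p r hr z).2 = (renormBox c p r hr y).2} =
      c.symm '' (Ioo (p.1 - r) (p.1 + r) ×ˢ {(c y).2}) := by
  obtain ⟨hyc, hybox⟩ := mem_renormBox_source_iff.1 hy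
  ext z
  simp only [mem_setOf_eq, mem_image, mem_prod, mem_Ioo, mem_singleton_iff]
  constructor
  · rintro ⟨hz, hh⟩
    obtain ⟨hzc, hzbox⟩ := mem_renormBox_source_iff.1 hz
    rw [renormBox_snd_eq_iff hz hy] at hh
    refine ⟨c z, ⟨(mem_box_iff.1 hzbox).1, hh⟩, c.left_inv hzc⟩
  · rintro ⟨v, ⟨hv1, hv2⟩, rfl⟩
    have hvbox : v ∈ box p r := by
      rw [mem_box_iff]
      refine ⟨hv1, ?_⟩
      rw [hv2]; exact (mem_box_iff.1 hybox).2
    have hvt : v ∈ c.target := hbox hvbox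
    have hz : c.symm v ∈ (renormBox c p r hr).source :=
      mem_renormBox_source (c.map_target hvt) (by rw [c.right_inv hvt]; exact hvbox)
    refine ⟨hz, ?_⟩
    rw [renormBox_snd_eq_iff hz hy, c.right_inv hvt, hv2]

/-- **Plaques of the renormalised charts are connected.** [folklore] -/
theorem isConnected_plaque {c : OpenPartialHomeomorph X (ℝ × ℝ)} {p : ℝ × ℝ} {r : ℝ} {hr : 0 < r}
    (hbox : box p r ⊆ c.target) {y : X} (hy : y ∈ (renormBox c p r hr).source) :
    IsConnected {z | z ∈ (renormBox c p r hr).source ∧ (renormBox c p r hr z).2 = (renormBox c p r hr y).2} := by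
  rw [plaque_eq_image hbox hy]
  have hseg : IsConnected (Ioo (p.1 - r) (p.1 + r) ×ˢ ({(c y).2} : Set ℝ)) :=
    (isConnected_Ioo (by linarith)).prod isConnected_singleton
  refine hseg.image _ (c.continuousOn_symm.mono ?_)
  rintro v ⟨hv1, hv2⟩
  apply hbox
  rw [mem_box_iff]
  refine ⟨hv1, ?_⟩
  rw [mem_singleton_iff.1 hv2]
  exact (mem_box_iff.1 (mem_renormBox_source_iff.1 hy).2).2

/-- **Plaques of the flow boxes of a pre-atlas foliation are connected.** [folklore] -/
theorem isConnected_plaque_of_mem (A : PreAtlas X) {e : OpenPartialHomeomorph X (ℝ × ℝ)} (he : e ∈ A.toFoliation.atlas)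
    {y : X} (hy : y ∈ e.source) : IsConnected {z | z ∈ e.source ∧ (e z).2 = (e y).2} := by
  obtain ⟨c, -, p, r, hr, hbox, rfl⟩ := he
  exact isConnected_plaque hbox hy

end PreAtlas

end Literature.Topology.PlanarFoliations
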